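import Literature.AnabelianGeometry.EtaleTheta.Discharge.Sec2Def27OrbitsOfStandardTypeModelChi
import HarnessLib

/-!
# [EtTh] Def. 2.7 «orbits of standard type» (`MuTwoSetting.OrbitsOfStandardType`, FACT-LIST F-0573): INSTANCE FORMS
# with conclusion head the typed predicate and no `Prop` hypotheses (proof-only companion; 0 definitions)

S. Mochizuki, *The étale theta function and its Frobenioid-theoretic manifestations* [EtTh], Publ. RIMS **45**
(2009), §2, Def. 2.7, PRIMS PDF p. 41 (printed 267) [cite: MochizukiEtTh2009, Def 2.7 p.41]: «If `η̈^{Θ,ℤ}` is of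
standard type, then we shall also refer to `η̈^{Θ,l·ℤ}`, `η̲̈^{Θ,l·ℤ}`, `η̈^{Θ,l·ℤ×μ₂}`, `η̲̈^{Θ,l·ℤ×μ₂}`, `η̈^{Θ,ℤ×μ₂}` as
being of standard type»; §1 Def. 1.9 (ii) p. 29 (the value of maximal order at `τ^{±1}` is `±1`).

Cell abc-iut, block F (instance-form wave INST59, KEY INST59J1 row F-0573), seat abc-iut-f-108 (gen 4). The
MATHEMATICS is abc-iut-f-132's (gen 4, `Discharge/Sec2Def27OrbitsOfStandardTypeModelChi.lean`, p461839, audited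
SOUND): at the Kummer-carrying χ-model `M := MuTwoSetting.modelχ p` (`Π^tp_X = Γ ⋊_χ G_{ℚ_p}`, `K = K̈ = ℚ_p`; étale theta
data `etaleThetaDataχSec p (etaDdχ p)` INHABITED — not the empty `EtaleThetaData` of the root model) the orbits derived
from the model's own non-trivial theta class `η̈^Θ := etaDdχ p` ARE of standard type for the Def. 1.9 datum whose points
`τ^{±1}` are the Galois-section point `inr(G_{ℚ_p})` of `Ÿ` labelled `√−1^{±1}` (`p ≡ 1 (mod 4)`, so that `√−1 ∈ ℚ_p`).
That file states it as `∃ S, … ∧ ∀ hC l C, OrbitsOfStandardType C hC ε_Z S` under the hypothesis `hp : p % 4 = 1`,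
a shape the cell's conclusion-head census files under another decl; THIS file only re-states the same content with
conclusion head `MuTwoSetting.OrbitsOfStandardType` and the Def. 1.9 datum written out as a term:
* `orbitsOfStandardType_etaDdχ_of_Dpt_le` — for EVERY `Compat` witness, EVERY Def. 1.9 datum `S` whose point `τ` is a
  Galois-section point, every `l` and EVERY choice `X̲̲ = C`: the orbits are of standard type (value set `{1}` at `τ`);
* `orbitsOfStandardType_modelχ` — **INSTANCE FORM** (carrier axioms `[Fact p.Prime] [Fact (p % 4 = 1)]` only; binders
  `l`, `C` are data): at the explicit datum `S_{√−1}` and `hC := MuTwoSetting.modelχ_compat p`, `ε_Z := epsZχ p`;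
* `orbitsOfStandardType_modelχ_five_three` — the same CLOSED at `p = 5`, `l = 3`, `X̲̲ := doubleUnderlineχSec 5 3`
  (abc-iut-L2-d1), i.e. the positive twin of abc-iut-f-132's closed refuter `MuTwoSetting.not_forall_orbitsOfStandardType`
  (same `p`, `l`; there the CONSTANT class of `(1+p)^3`, here the model's theta class).
HONEST FRAMING: a SEMI-SYNTHETIC carrier (the χ-twisted root, not the tempered `π₁` of a curve; the value `1` at the
Galois-section point is not the printed `Θ̈(√−1)`); an instance of OUR typed predicate ≠ the printed definition being
«satisfied in IUT»; a FACT row is an assumption label; typed ≠ proved; no side is taken on [IUTchIII] Cor. 3.12.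
-/

noncomputable section

namespace Literature.AnabelianGeometry.EtaleTheta.SettingModel

open Literature.AnabelianGeometry.SemiGraphs

variable (p : ℕ) [Fact p.Prime]

/-- **Def. 2.7 at `modelχ` for every Galois-section datum**: if the point `τ` of the Def. 1.9 datum `S` is a
Galois-section point of `Ÿ` (`D_τ ≤ inr(G_{ℚ_p})`), then for every `Compat` witness, every `l` and every choice
`X̲̲ = C` the orbits derived from the model's theta class `etaDdχ p` are of standard type — the set of values at
`τ` is `{1}` (abc-iut-f-132's `valuesAt_etaDdχ_eq_singleton_one`). [cite: MochizukiEtTh2009, Def 2.7 p.41] -/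
theorem orbitsOfStandardType_etaDdχ_of_Dpt_le (hC : (ThetaSetting.modelχ p).Compat)
    (S : (MuTwoSetting.modelχ p).StandardData (kummerDataχSec p))
    (hD : S.tau.Dpt ≤ (ThetaSetting.modelχ p).GKdd.map (SemidirectProduct.inr : GQp p →* PiTpχ p))
    (l : ℕ) (C : (etaleThetaDataχSec p (etaDdχ p)).DoubleUnderline l) :
    Literature.AnabelianGeometry.EtaleTheta.MuTwoSetting.OrbitsOfStandardType (M := MuTwoSetting.modelχ p) C hC
      (epsZχ p) S := by
  refine ⟨_, Or.inl rfl, 1, ?_, ?_, one_mem _, Or.inl rfl⟩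
  · change (1 : (↥(ThetaSetting.modelχ p).Kdd)ˣ) ∈
      MuTwoSetting.valuesAt (M := MuTwoSetting.modelχ p) hC (epsZχ p) (etaDdχ p) S.tau
    rw [valuesAt_etaDdχ_eq_singleton_one p hC S.tau hD]
    exact Set.mem_singleton 1
  · intro w hw
    change w ∈ MuTwoSetting.valuesAt (M := MuTwoSetting.modelχ p) hC (epsZχ p) (etaDdχ p) S.tau at hw
    rw [valuesAt_etaDdχ_eq_singleton_one p hC S.tau hD, Set.mem_singleton_iff] at hw
    rw [hw]

/-- **F-0573 INSTANCE FORM at the Kummer-carrying χ-model** (`p ≡ 1 (mod 4)` as a carrier axiom `[Fact (p % 4 = 1)]`,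
so that `√−1 ∈ ℚ_p = K̈`): for every `l` and EVERY choice `X̲̲ = C` over the étale theta datum of the model's own
theta class `etaDdχ p`, the orbits `η̈^{Θ,l·ℤ}, …, η̈^{Θ,ℤ×μ₂}` are of standard type for the explicit Def. 1.9 datum
`S_{√−1}`: `√−1 := sqrtNegOneχ p`, `τ^{±1} :=` the Galois-section point `nonCuspidalPointχ p` re-labelled
`√−1^{±1}`; `hC := MuTwoSetting.modelχ_compat p`, `ε_Z := epsZχ p` (the `a`-loop). Semi-synthetic carrier; an
instance of OUR typed predicate only. [cite: MochizukiEtTh2009, Def 2.7 p.41] -/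
theorem orbitsOfStandardType_modelχ [hp4 : Fact (p % 4 = 1)] (l : ℕ)
    (C : (etaleThetaDataχSec p (etaDdχ p)).DoubleUnderline l) :
    Literature.AnabelianGeometry.EtaleTheta.MuTwoSetting.OrbitsOfStandardType (M := MuTwoSetting.modelχ p) C
      (MuTwoSetting.modelχ_compat p) (epsZχ p)
      { sqrtNegOne := sqrtNegOneχ p hp4.out
        sqrtNegOne_mem := sqrtNegOneχ_mem_K p hp4.out
        sqrtNegOne_sq := sqrtNegOneχ_sq p hp4.out
        tau := { nonCuspidalPointχ p with
          coord := sqrtNegOneUnitχ p hp4.out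
          coord_ne_cusp := sqrtNegOneUnitχ_ne_cusp p hp4.out }
        tauInv := { nonCuspidalPointχ p with
          coord := sqrtNegOneInvUnitχ p hp4.out
          coord_ne_cusp := sqrtNegOneInvUnitχ_ne_cusp p hp4.out }
        tau_coord := coe_sqrtNegOneUnitχ p hp4.out
        tauInv_coord := coe_sqrtNegOneInvUnitχ p hp4.out } :=
  orbitsOfStandardType_etaDdχ_of_Dpt_le p (MuTwoSetting.modelχ_compat p) _ le_rfl l C

/-- **F-0573, CLOSED INSTANCE at `p = 5`, `l = 3`** (the positive twin of abc-iut-f-132's closed refuter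
`MuTwoSetting.not_forall_orbitsOfStandardType`, which uses the same `p`, `l` with a CONSTANT Kummer class): at
`M := MuTwoSetting.modelχ 5`, `X̲̲ := doubleUnderlineχSec 5 3` (abc-iut-L2-d1), `hC := modelχ_compat 5`, `ε_Z := epsZχ 5`
and the explicit Def. 1.9 datum `S_{√−1}` (`√−1 ∈ ℚ_5`), the orbits of the model's theta class are of standard type.
Only the carrier axiom `[Fact (Nat.Prime 5)]` is bound. [cite: MochizukiEtTh2009, Def 2.7 p.41] -/
theorem orbitsOfStandardType_modelχ_five_three [Fact (Nat.Prime 5)] :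
    Literature.AnabelianGeometry.EtaleTheta.MuTwoSetting.OrbitsOfStandardType (M := MuTwoSetting.modelχ 5)
      (doubleUnderlineχSec 5 3 (by decide)) (MuTwoSetting.modelχ_compat 5) (epsZχ 5)
      { sqrtNegOne := sqrtNegOneχ 5 (by decide)
        sqrtNegOne_mem := sqrtNegOneχ_mem_K 5 (by decide)
        sqrtNegOne_sq := sqrtNegOneχ_sq 5 (by decide)
        tau := { nonCuspidalPointχ 5 with
          coord := sqrtNegOneUnitχ 5 (by decide)
          coord_ne_cusp := sqrtNegOneUnitχ_ne_cusp 5 (by decide) }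
        tauInv := { nonCuspidalPointχ 5 with
          coord := sqrtNegOneInvUnitχ 5 (by decide)
          coord_ne_cusp := sqrtNegOneInvUnitχ_ne_cusp 5 (by decide) }
        tau_coord := coe_sqrtNegOneUnitχ 5 (by decide)
        tauInv_coord := coe_sqrtNegOneInvUnitχ 5 (by decide) } :=
  haveI : Fact (5 % 4 = 1) := ⟨by decide⟩
  orbitsOfStandardType_modelχ 5 3 _

/-- **Census pair for F-0573 in one statement** (`p = 5`, `l = 3`): the typed Def. 2.7 HOLDS at one étale-theta
datum of `modelχ 5` (the model's theta class, instance above) and its universal closure over all binders is FALSE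
(abc-iut-f-132: the constant class of `(1+5)^3` at the same model). [cite: MochizukiEtTh2009, Def 2.7 p.41] -/
theorem orbitsOfStandardType_instance_and_closure_refuted [Fact (Nat.Prime 5)] :
    (∃ S : (MuTwoSetting.modelχ 5).StandardData (kummerDataχSec 5),
      Literature.AnabelianGeometry.EtaleTheta.MuTwoSetting.OrbitsOfStandardType (M := MuTwoSetting.modelχ 5)
        (doubleUnderlineχSec 5 3 (by decide)) (MuTwoSetting.modelχ_compat 5) (epsZχ 5) S) ∧
    ¬ ∀ (p : ℕ) [Fact p.Prime] (M : MuTwoSetting p) (E : M.toThetaSetting.EtaleThetaData) (l : ℕ)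
        (C : E.DoubleUnderline l) (hC : M.toThetaSetting.Compat) (εZ : M.GtpC) (S : M.StandardData E.toKummerData),
        MuTwoSetting.OrbitsOfStandardType C hC εZ S :=
  ⟨⟨_, orbitsOfStandardType_modelχ_five_three⟩, MuTwoSetting.not_forall_orbitsOfStandardType⟩

end Literature.AnabelianGeometry.EtaleTheta.SettingModel

end
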